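import Summits.BirchSwinnertonDyer.BirchSwinnertonDyer.Theorems.SylvesterTwoHeegnerIndexUpperOffV0KolyvaginClassesAssemblyOfH44
import Summits.BirchSwinnertonDyer.BirchSwinnertonDyer.Theorems.SylvesterTwoHeegnerIndexUpperOffV0H44ConcreteSupersingular
import Summits.BirchSwinnertonDyer.BirchSwinnertonDyer.Theorems.KolyvaginRankRigidityAtTwoAdmissibleAtTwo
import Summits.BirchSwinnertonDyer.BirchSwinnertonDyer.Theorems.CMKolyvaginAtInertTwoKolyvaginPrimeInertAtTwo
import Summits.BirchSwinnertonDyer.Rank1Residual.Partition.MainConjecturesCMInert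
import Summits.BirchSwinnertonDyer.Rank1Residual.P2.CMKolyvaginMachineBindersAtTwo
import Literature.NumberTheory.EllipticCurves.GrossLMS1991.HeegnerEulerSystemCongruenceInert
import Literature.NumberTheory.EllipticCurves.HeegnerPointsOfConductorPrimeLevelProofs
import Literature.NumberTheory.EllipticCurves.HeegnerPointsOfConductorOneGaloisConjProofs
import Literature.NumberTheory.EllipticCurves.ModularityVersionApProofs
import HarnessLib

/-!
# Route `CMKolyvaginAtInertTwo`, crux `CMKolyvaginExactAtInertTwo` (stmt-BirchSwinnertonDyer-24277):
# ITEM (0b) ON THE HABITAT H₂ — Kolyvagin's point system AT `p = 2` for CM curves with `2` inert, at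
# EVERY level `2^M`, modulo Gross's Prop. 5.3, Gross–Zagier III (3.1) and the named fact Prop. 3.7 (2)

Seat `bsd-line-cmk2-p1` g9 (cell `bsd-print-cf2`); helper (`--supports stmt-BirchSwinnertonDyer-24277`).
THEOREMS ONLY (no definition, no named fact, no instance, no `sorry`); no item is closed; BSD is not
proved by this.

WHAT. The pen's booking memo (`BOOKING-TARGET-H2-levelzero.md` v2 §2) names as the ONE research input of
the H₂ level-zero class theorem the machine's point-system DATA at `p = 2` (item (0b): ty2's
`PointSystemFamily (W.conductorNorm ℤ) W K P 2 (CMInert W)`, Gross §§3–6 / McCallum §4 at `p = 2` for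
CM curves — "not print, not in the tree"). It IS in the tree, two cells away: the K7t road of cell
`bsd-cm` (route `SylvesterTwoHeegnerIndex`, seats k7t-c2 g6–g8) re-ran x11b3's per-level-choice assembly
of the `hpoints` binder for ANY prime (`SylvesterTwoUpper.hpoints_at_of_perLevelChoice_of_admissible_of_h44`,
inputs {`hrec`, `hCM`, `h53`, `hGZ`, `hAdm`, `h44`}) and supplied the `2`-adic local clause `h44`
(McCallum Prop. 4.4 / Gross 6.2 (2) at `λ ∣ m`) at SUPERSINGULAR Kolyvagin primes by the free-module
mechanism (`h44_concrete_of_traceRelation_of_congruence_of_supersingular`: the odd-`p` cyclic-eigenspace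
step replaced by "`Ẽ(𝔽_{ℓ²})[2^∞]` free of rank `2`" when `a_ℓ = 0`; its inputs are Gross 3.7 (1) —
the tree THEOREM `prop37_1_traceRelation_holds` — and Gross 3.7 (2) as the binder `hγ`). On H₂ every
Gross-form Kolyvagin prime of `(2, 1)` is CM-inert (g6, `KolyvaginDescentTwo.cmInert_of_isKolyvaginPrime_two`)
hence has `a_ℓ = 0` (Deuring, `Rank1Residual.frobeniusTrace_eq_zero_of_hasCM_of_cmInert`), the
admissibility input `hAdm` = Gross Lemma 4.3 at `2` is bsd-f1-sign2's
`KolyvaginAtTwo.isAdmissible_pointsSubgroup_two_of_heegner` (`ρ̄₂` onto, odd `d_K`,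
Heegner for `N_E`), `hrec` (Shimura reciprocity at conductor 1) is the tree theorem
`heegnerPointOfConductor_one_galoisConj_holds`, `hCM` (rationality of `φ(x_m)` over `K[m]`, Gross §3 /
Darmon Thm. 3.6) is the tree theorem `phi_heegnerPointOfConductor_mem_range_map_ringClassField_of_ne_zero`,
and `hγ` follows from the NAMED Literature fact `GrossLMS1991.prop37_2_reductionCongruence_inert N W K`
(`….family_of_grossKolyvaginPrime`; Kolyvagin primes at `2` are odd). So:

* `frobeniusTrace_eq_zero_of_isKolyvaginPrime_two_of_cmInert` — on H₂, `a_ℓ = 0` at every Gross-form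
  Kolyvagin prime `ℓ` of `(2, ·)`.
* `hpoints_two_of_cmInert_of_printedInputs` — **THE MACHINE'S POINT-SYSTEM BINDER `hpoints` AT `p = 2`,
  FULL SUPPORT, EVERY LEVEL `2^M`, for every `W ∈ H₂` (`HasCM`, `CMInert W 2`, `ρ̄_{W,2}` onto, globally
  minimal), every imaginary quadratic `K` with odd `d_K ≠ −3` and the Heegner hypothesis for `N_E`, every
  Heegner point `P` of level `N_E`** — CONDITIONAL on EXACTLY: the named fact
  `prop37_2_reductionCongruence_inert N_E W K` and the two cite-only printed statements `h53` (Gross Prop.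
  5.3: complex conjugation on `y_m` is `−ε` times a Galois conjugate up to torsion) and `hGZ` (Gross–Zagier
  III (3.1): the `y_m` meet the identity component at the bad places, up to a factor prime to `2`) — the
  binders of the odd-`p` X11b road VERBATIM at `p = 2`.
* `nonempty_pointSystemFamily_two_of_cmInert_of_printedInputs` — the same as ty2's DATA:
  `Nonempty (PointSystemFamily (W.conductorNorm ℤ) W K P 2 S)` for every support `S` (item (0b), and a
  fortiori (0b)₂¹).

HONEST FRAMING: a COMPOSITION of other cells' theorems (x11b3 / k7t-c2 / bsd-f1-sign2 / gross37 typers),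
no new mathematics; conditional on one named fact and two printed statements displayed as binders; beyond
print: NO (Gross §§3–6 and McCallum §4 carry no parity hypothesis before McCallum §5; the `p = 2`
supersingular replacement of Prop. 4.4's eigenspace step is k7t-c2's). BSD is not proved by this.

References: [GrossLMS1991] §3 (3.1)–(3.5), Props. 3.6, 3.7, §4 (4.1)–(4.6), Lemma 4.3, Props. 5.3, 5.4,
6.2; [McCallumLMS1991] §4 (4)–(6), Lemma 4.3, Prop. 4.4; [GrossZagier1986] III (3.1); [Darmon2004] Thm.
3.6–3.7; [Lang1987] Ch. 13 §4 Thm. 12 (Deuring).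
-/

-- single-conjunct summit: `Summit.BirchSwinnertonDyer.BirchSwinnertonDyer.…` repeats the name by design
set_option linter.dupNamespace false
set_option autoImplicit false

noncomputable section

open scoped Classical
open WeierstrassCurve Field NumberField IsDedekindDomain Finset
open Literature.NumberTheory.EllipticCurves Literature.NumberTheory.GaloisRepresentations
open Literature.NumberTheory.EllipticCurves.KolyvaginCocycle
open Literature.NumberTheory.EllipticCurves.KolyvaginEuler
open Literature.NumberTheory.EllipticCurves.RingClassField
open Literature.NumberTheory.EllipticCurves.ModularForms
open Literature.NumberTheory.EllipticCurves.Rank1Residual (CMInert)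
open Summit.BirchSwinnertonDyer.Rank1Residual.X11b
open Summit.BirchSwinnertonDyer.Rank1Residual.X11b.KolyvaginAssembly

namespace Summit.BirchSwinnertonDyer.BirchSwinnertonDyer.Theorems.CMPointSystemTwo

-- `K : Type`: the tree's ring-class class field theory is universe `0`.
variable {K : Type} [Field K] [NumberField K] {N : ℕ} {W : WeierstrassCurve ℚ}

/-! ## §1 `a_ℓ = 0` at the Kolyvagin primes of `2` on H₂ (Deuring) -/

/-- **On H₂ every Gross-form Kolyvagin prime `ℓ` of `2` has `a_ℓ(E) = 0`**: `ℓ` is CM-inert (g6's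
`KolyvaginDescentTwo.cmInert_of_isKolyvaginPrime_two`: `Frob_ℓ` is a transposition on `E[2]`, so `ℓ` is
inert in `F = ℚ(√Δ_E)`), `ℓ ∤ N_E` is good reduction, `ℓ ≠ 2`, and Deuring gives `a_ℓ = 0` at an odd
good prime inert in the CM field (`Rank1Residual.frobeniusTrace_eq_zero_of_hasCM_of_cmInert`).
[cite: Lang1987, Ch. 13 §4 Thm. 12] [cite: GrossLMS1991, §3 (3.1)–(3.3)] -/
theorem frobeniusTrace_eq_zero_of_isKolyvaginPrime_two_of_cmInert [W.IsElliptic] [W.IsGloballyMinimal]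
    (hCM : W.HasCM) (hin : CMInert W 2) (hsurj : W.HasSurjectiveModNGaloisRep 2) {ℓ : ℕ}
    (hℓ : IsKolyvaginPrime (W.conductorNorm ℤ) W K 2 ℓ) : W.frobeniusTrace ℓ = 0 := by
  haveI : Fact ℓ.Prime := ⟨hℓ.prime⟩
  have hgood : W.HasGoodReductionAtPrime ℓ := by
    by_contra h
    exact hℓ.2.1 ((W.dvd_conductorNorm_iff_not_hasGoodReductionAtPrime ℓ).mpr h)
  exact Rank1Residual.frobeniusTrace_eq_zero_of_hasCM_of_cmInert hCM hℓ.2.2.2.1 hgood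
    (KolyvaginDescentTwo.cmInert_of_isKolyvaginPrime_two W hCM hin hsurj hℓ)

/-! ## §2 The point system at `2` on H₂, every level, modulo {Prop. 3.7 (2) by name, `h53`, `hGZ`} -/

/-- **KOLYVAGIN'S POINT SYSTEM AT `p = 2` ON H₂ (the machine's binder `hpoints`, full support, every
level `2^M`)** — for `W/ℚ` globally minimal with CM, `2` inert in the CM field, `ρ̄_{W,2}` onto; `K`
imaginary quadratic with odd `d_K ≠ −3` and the Heegner hypothesis for `N = N_E`; `P` a Heegner point of
level `N`: GIVEN the named fact `prop37_2_reductionCongruence_inert N W K` (Gross Prop. 3.7 (2),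
image-free) and the printed statements `h53` (Gross Prop. 5.3) and `hGZ` (Gross–Zagier III (3.1)) in the
binder shapes of the odd-`p` X11b road at `p = 2`, for every `M ≥ 1`, every `2^M`-divisibility witness
and every conjugation `c ≠ 1` there are a sign `ε`, a lift `τ`, admissible `τ`-stable `A_m = E(K[m])`,
points `P_m` with `P_1 = P`, Gross 5.4 (1), 6.2 (1) off `m`, and McCallum 4.4 at `λ ∣ m` — i.e. the
conclusion of `hpoints_of_pointSystemFamily` with support `⊤`. See the module docstring for which tree
theorem supplies which input. [cite: GrossLMS1991, §3 Props. 3.6, 3.7, §4 (4.1), Lemma 4.3, Props. 5.3,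
5.4, 6.2] [cite: McCallumLMS1991, §4 (4)–(6), Lemma 4.3, Prop. 4.4] [cite: GrossZagier1986, III (3.1)] -/
theorem hpoints_two_of_cmInert_of_printedInputs [NeZero N] [W.IsGloballyMinimal] [W.IsElliptic]
    (hN : N = W.conductorNorm ℤ) (hCMW : W.HasCM) (hin : CMInert W 2)
    (hsurj : W.HasSurjectiveModNGaloisRep 2) (hK : IsImaginaryQuadratic K)
    (hodd : Odd (NumberField.discr K)) (h3 : NumberField.discr K ≠ -3)
    (hH : SatisfiesHeegnerHypothesis N K) {P : (W.baseChange K).toAffine.Point}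
    (hHP : IsHeegnerPoint N W K P)
    (h372 : GrossLMS1991.prop37_2_reductionCongruence_inert N W K)
    (h53 : ∀ [W.IsElliptic] (_hK : IsImaginaryQuadratic K) (_hH : SatisfiesHeegnerHypothesis N K)
      (Dt : ModularParametrizationData W N) (β : ℤ) (ι : K →+* ℂ) {M : ℕ}
      (_hM : 1 ≤ M) {n : ℕ} (_hn : Squarefree n)
      (_hKol : ∀ q ∈ n.primeFactors, IsKolyvaginPrime N W K 2 q ∧ FrobEqFrobInfty W K (2 ^ M) q)
      (d : (m : ℕ) → m ∣ n → KolyvaginHeegnerData Dt β ι m) (m : ℕ) (hm : m ∣ n)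
      (τm : ringClassField K ι m ≃ₐ[ℚ] ringClassField K ι m),
      (∀ x : ringClassField K ι m, ((τm x : ringClassField K ι m) : ℂ) = starRingEnd ℂ x) →
      ∃ σ' ∈ ringClassGal ι m, IsOfFinAddOrder
        (pointGalHom W (ringClassField K ι m) τm (d m hm).y -
          (-W.rootNumber) • pointGalHom W (ringClassField K ι m) σ' (d m hm).y))
    (hGZ : ∀ [W.IsElliptic] (_hK : IsImaginaryQuadratic K) (_hH : SatisfiesHeegnerHypothesis N K)
      (Dt : ModularParametrizationData W N) (β : ℤ) (ι : K →+* ℂ) {M : ℕ} (_hM : 1 ≤ M) {n : ℕ}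
      (_hn : Squarefree n)
      (_hKol : ∀ q ∈ n.primeFactors, IsKolyvaginPrime N W K 2 q ∧ FrobEqFrobInfty W K (2 ^ M) q)
      (d : (m : ℕ) → m ∣ n → KolyvaginHeegnerData Dt β ι m),
      ∃ n' : ℤ, IsCoprime ((2 ^ M : ℕ) : ℤ) n' ∧
        ∀ (m : ℕ) (hm : m ∣ n) (γ : ringClassField K ι m ≃ₐ[ℚ] ringClassField K ι m),
          γ ∈ ringClassGal ι m → ∀ v : HeightOneSpectrum (𝓞 K),
            ¬ (W.baseChange K).HasGoodReductionAt v →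
            n' • pointsMap (W.baseChange K) (v.adicCompletion K)
                ((d m hm).toGeomPoints (pointGalHom W (ringClassField K ι m) γ (d m hm).y)) ∈
              E0Receptacle (W.baseChange K) v ∧
            ∀ (ℓ : ℕ) (hℓ : ℓ ∈ m.primeFactors)
              (hle : ringClassField K ι (m / ℓ) ≤ ringClassField K ι m),
              n' • pointsMap (W.baseChange K) (v.adicCompletion K)
                  ((d m hm).toGeomPoints (pointGalHom W (ringClassField K ι m) γ
                    (WeierstrassCurve.Affine.Point.map (W' := W)
                      ((RingClassField.inclusion ι hle).restrictScalars ℚ)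
                      (d (m / ℓ)
                        ((Nat.div_dvd_of_dvd (Nat.dvd_of_mem_primeFactors hℓ)).trans hm)).y))) ∈
                E0Receptacle (W.baseChange K) v) :
    ∀ {M : ℕ} (_hM : 1 ≤ M)
      (hdiv : ∀ Q : geomPoints (W.baseChange K), ∃ R, ((2 ^ M : ℕ) : ℤ) • R = Q)
      (c : K ≃ₐ[ℚ] K) (_hc : c ≠ 1),
      ∃ (ε : ℤ) (τ : AlgebraicClosure K ≃+* AlgebraicClosure K) (hτ : IsLiftOfAut c τ)
        (A : ℕ → AddSubgroup (geomPoints (W.baseChange K)))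
        (hA : ∀ m, KolyvaginCocycle.IsAdmissible (Field.absoluteGaloisGroup K) (A m)
          ((2 ^ M : ℕ) : ℤ))
        (Pt : ℕ → geomPoints (W.baseChange K))
        (hPt : ∀ m, Pt m ∈
          KolyvaginCocycle.invPoints (Field.absoluteGaloisGroup K) (A m) ((2 ^ M : ℕ) : ℤ)),
        (ε = 1 ∨ ε = -1) ∧
        IsOfFinAddOrder (Affine.Point.map (W' := W) (c : K →ₐ[ℚ] K) P - ε • P) ∧
        (∀ m, ∀ a ∈ A m, hτ.pointsMap W a ∈ A m) ∧
        Pt 1 = toGeomPoints (W.baseChange K) P ∧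
        (∀ m : ℕ, Squarefree m →
          (∀ q ∈ m.primeFactors, IsKolyvaginPrime N W K 2 q ∧ FrobEqFrobInfty W K (2 ^ M) q) →
          (∃ B ∈ A m, hτ.pointsMap W (Pt m) =
            (ε * (-1) ^ m.primeFactors.card) • Pt m + ((2 ^ M : ℕ) : ℤ) • B) ∧
          (∀ v : HeightOneSpectrum (𝓞 K), (m : 𝓞 K) ∉ v.asIdeal →
            kolyvaginClass (W.baseChange K) _ hdiv (hA m) (Pt m) (hPt m) ∈
              selmerLocalKer (W.baseChange K) (v.adicCompletion K) ((2 ^ M : ℕ) : ℤ)) ∧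
          (∀ ℓ : ℕ, ℓ.Prime → ℓ ∣ m → ∀ v : HeightOneSpectrum (𝓞 K), (ℓ : 𝓞 K) ∈ v.asIdeal →
            ∀ a : ℕ, ((((2 : ℕ) : ℤ) ^ a) •
                kolyvaginClass (W.baseChange K) _ hdiv (hA m) (Pt m) (hPt m) ∈
                selmerLocalKer (W.baseChange K) (v.adicCompletion K) ((2 ^ M : ℕ) : ℤ) ↔
              (((2 : ℕ) : ℤ) ^ a) • kolyvaginClass (W.baseChange K) _ hdiv (hA (m / ℓ)) (Pt (m / ℓ))
                  (hPt (m / ℓ)) ∈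
                (W.baseChange K).torsionLocalKer (v.adicCompletion K) ((2 ^ M : ℕ) : ℤ)))) := by
  subst hN
  intro M hM hdiv c hc
  have h4 : NumberField.discr K ≠ -4 := fun h ↦ by
    rw [h] at hodd
    exact (Int.not_even_iff_odd.mpr hodd) ⟨-2, by norm_num⟩
  have hD34 : NumberField.discr K ≠ -3 ∧ NumberField.discr K ≠ -4 := ⟨h3, h4⟩
  refine SylvesterTwoUpper.hpoints_at_of_perLevelChoice_of_admissible_of_h44 rfl hK hD34 hH hHP
    Nat.prime_two (heegnerPointOfConductor_one_galoisConj_holds (W.conductorNorm ℤ) W K) ?_ h53 hGZ ?_ ?_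
    hM hdiv c hc
  · -- `hCM`: rationality of `φ(x_m)` over `K[m]` (Gross §3 / Darmon Thm. 3.6) — a THEOREM of the tree
    intro _ hK' _ Dt β ι hβ M _ m hm _
    exact phi_heegnerPointOfConductor_mem_range_map_ringClassField_of_ne_zero (W.conductorNorm ℤ) W K
      hK' Dt β ι m hβ (Squarefree.ne_zero hm)
  · -- `hAdm`: Gross Lemma 4.3 at `2` on H₂ (`ρ̄₂` onto, odd `d_K`, Heegner for `N_E`)
    intro Dt β ι M n hn _ d
    exact KolyvaginAtTwo.isAdmissible_pointsSubgroup_two_of_heegner d hsurj hK hodd hH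
      (Squarefree.ne_zero hn) M
  · -- `h44`: McCallum 4.4 at the (supersingular) Kolyvagin primes of `2`, from Gross 3.7 (1) (theorem),
    -- Gross 3.7 (2) (named fact) and `a_ℓ = 0` (Deuring on H₂)
    intro _ _ hK' ι P' hHP' M' hM' Dt β' hND hD n' hn hKol d hcoh hA hPt hI
    exact SylvesterTwoUpper.h44_concrete_of_traceRelation_of_congruence_of_supersingular hK' ι hHP'
      Nat.prime_two hM'
      (fun ℓ hℓ _ ↦ frobeniusTrace_eq_zero_of_isKolyvaginPrime_two_of_cmInert hCMW hin hsurj hℓ)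
      Dt hND hD hn hKol d hcoh
      (h372.family_of_grossKolyvaginPrime rfl hK' hD34 hH Dt β' ι hn
        (fun q hq ↦ (hKol q hq).1.2.2.2.1) (fun q hq ↦ (hKol q hq).1) d)
      hA hPt hI

/-! ## §3 ty2's DATA is inhabited on H₂ modulo the same inputs -/

/-- **Item (0b) on H₂ as ty2's structure**: under the hypotheses of
`hpoints_two_of_cmInert_of_printedInputs`, `Nonempty (PointSystemFamily N W K P 2 S)` for EVERY support
`S` (the family with full support restricts; in particular the CM-inert support of the route and, level
by level, the prime-level packages `(· = ℓ)`). [cite: GrossLMS1991, §3 Props. 3.6, 3.7, §4 (4.1), Lemma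
4.3, Props. 5.3, 5.4, 6.2] [cite: McCallumLMS1991, §4 Prop. 4.4] [cite: GrossZagier1986, III (3.1)] -/
theorem nonempty_pointSystemFamily_two_of_cmInert_of_printedInputs [NeZero N] [W.IsGloballyMinimal]
    [W.IsElliptic] (hN : N = W.conductorNorm ℤ) (hCMW : W.HasCM) (hin : CMInert W 2)
    (hsurj : W.HasSurjectiveModNGaloisRep 2) (hK : IsImaginaryQuadratic K)
    (hodd : Odd (NumberField.discr K)) (h3 : NumberField.discr K ≠ -3)
    (hH : SatisfiesHeegnerHypothesis N K) {P : (W.baseChange K).toAffine.Point}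
    (hHP : IsHeegnerPoint N W K P)
    (h372 : GrossLMS1991.prop37_2_reductionCongruence_inert N W K)
    (h53 : ∀ [W.IsElliptic] (_hK : IsImaginaryQuadratic K) (_hH : SatisfiesHeegnerHypothesis N K)
      (Dt : ModularParametrizationData W N) (β : ℤ) (ι : K →+* ℂ) {M : ℕ}
      (_hM : 1 ≤ M) {n : ℕ} (_hn : Squarefree n)
      (_hKol : ∀ q ∈ n.primeFactors, IsKolyvaginPrime N W K 2 q ∧ FrobEqFrobInfty W K (2 ^ M) q)
      (d : (m : ℕ) → m ∣ n → KolyvaginHeegnerData Dt β ι m) (m : ℕ) (hm : m ∣ n)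
      (τm : ringClassField K ι m ≃ₐ[ℚ] ringClassField K ι m),
      (∀ x : ringClassField K ι m, ((τm x : ringClassField K ι m) : ℂ) = starRingEnd ℂ x) →
      ∃ σ' ∈ ringClassGal ι m, IsOfFinAddOrder
        (pointGalHom W (ringClassField K ι m) τm (d m hm).y -
          (-W.rootNumber) • pointGalHom W (ringClassField K ι m) σ' (d m hm).y))
    (hGZ : ∀ [W.IsElliptic] (_hK : IsImaginaryQuadratic K) (_hH : SatisfiesHeegnerHypothesis N K)
      (Dt : ModularParametrizationData W N) (β : ℤ) (ι : K →+* ℂ) {M : ℕ} (_hM : 1 ≤ M) {n : ℕ}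
      (_hn : Squarefree n)
      (_hKol : ∀ q ∈ n.primeFactors, IsKolyvaginPrime N W K 2 q ∧ FrobEqFrobInfty W K (2 ^ M) q)
      (d : (m : ℕ) → m ∣ n → KolyvaginHeegnerData Dt β ι m),
      ∃ n' : ℤ, IsCoprime ((2 ^ M : ℕ) : ℤ) n' ∧
        ∀ (m : ℕ) (hm : m ∣ n) (γ : ringClassField K ι m ≃ₐ[ℚ] ringClassField K ι m),
          γ ∈ ringClassGal ι m → ∀ v : HeightOneSpectrum (𝓞 K),
            ¬ (W.baseChange K).HasGoodReductionAt v →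
            n' • pointsMap (W.baseChange K) (v.adicCompletion K)
                ((d m hm).toGeomPoints (pointGalHom W (ringClassField K ι m) γ (d m hm).y)) ∈
              E0Receptacle (W.baseChange K) v ∧
            ∀ (ℓ : ℕ) (hℓ : ℓ ∈ m.primeFactors)
              (hle : ringClassField K ι (m / ℓ) ≤ ringClassField K ι m),
              n' • pointsMap (W.baseChange K) (v.adicCompletion K)
                  ((d m hm).toGeomPoints (pointGalHom W (ringClassField K ι m) γ
                    (WeierstrassCurve.Affine.Point.map (W' := W)
                      ((RingClassField.inclusion ι hle).restrictScalars ℚ)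
                      (d (m / ℓ)
                        ((Nat.div_dvd_of_dvd (Nat.dvd_of_mem_primeFactors hℓ)).trans hm)).y))) ∈
                E0Receptacle (W.baseChange K) v) (S : ℕ → Prop) :
    Nonempty (Rank1Residual.P2.KolyvaginMachine.PointSystemFamily N W K P 2 S) := by
  refine ⟨fun M hM hdiv c hc ↦ Classical.choice ?_⟩
  obtain ⟨ε, τ, hτ, A, hA, Pt, hPt, hε, hc1, hAτ, hPt1, hrel⟩ :=
    hpoints_two_of_cmInert_of_printedInputs hN hCMW hin hsurj hK hodd h3 hH hHP h372 h53 hGZ hM hdiv c hc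
  exact ⟨⟨ε, τ, hτ, A, hA, Pt, hPt, hε, hc1, hAτ, hPt1,
    fun m hm hq ↦ hrel m hm fun q hq' ↦ ⟨(hq q hq').1, (hq q hq').2.1⟩⟩⟩

end Summit.BirchSwinnertonDyer.BirchSwinnertonDyer.Theorems.CMPointSystemTwo

end
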